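import Mathlib

/-!
# `Balaban1983to89.B6Eq296UnitJacobian` — T. Bałaban, *Propagators and renormalization transformations for lattice
# gauge theories. II*, Commun. Math. Phys. **96** (1984) 223–250 [Balaban1984PropagatorsII], Sect. C (2.96) p. 240:
# the UNIT JACOBIAN of the block-gauge `δ`-functions — *"from the definition of δ_Ax we have
# ∫dω′↾_Λ δ(Q′₁ω′) Π_{y∈Λ′} δ_{Ax(y)}(Q_jA + ∂₁ω′) = 1 (2.96)"* — PROVED: the linear chart
# `ω′ ↦ ((Q′₁ω′)(y))_{y∈Λ′} ⊕ (ω′(x) − ω′(y))_{x∈B(y), x≠y}` of `ℝ^Λ` has determinant `1`, hence preserves Lebesgue measure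

statement-level skeleton of published theorems with citation tags; proofs where landed; nothing here is a claim about the Yang–Mills mass gap

PDF held: `paper:balaban1984-cmp96-propagators-rt-ii` (journal page = PDF page + 222); p. 240 read AS IMAGE on the ×2
render `run/shared/lean/pub/pub-balaban/b2b-balaban-ref1/pages/1984-cmp96-propagators-rt-II/…-p018-x2.png`, and [4] =
[Balaban1984PropagatorsI] pp. 18–21 (the block averages (1.8), the axial gauge (1.10), the change of gauge (1.22)–(1.23))
on `…/1984-cmp95-propagators-rt-I/…-p002…p005-x2.png`, by this seat (2026-08-21).

CITATION HEADER (lean-in-tree rule).  WHAT IS REPRODUCED: the member (2.96) of lit-balaban SKELETON row **B6.Eq2.95**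
((2.95)–(2.97) p. 240; cell note of record, ROWS-B6 v1.21 owner r03: *"(2.96): exactly one admissible ω′ per
configuration = `…B5.HierGauge.complete`/`unique` (kernel-checked), its unit Jacobian NOT typed"*; the same note is
carried by the module headers of `…B6Eq295`, `…B5ChangeOfGauge123`, `…B6Eq2106`).  PHASE-2 seat p22 (gen 5); owner
r03, referee ref-4.  IMPORTS: Mathlib only; no declaration of the tree is restated (the existence-and-uniqueness half
is re-obtained here for the one-level block structure as the invertibility of the chart, `chart_existsUnique`; the
hierarchical, all-levels statement stays `…B5.HierGauge` / `…B5HierGaugeTorus.hierGauge_existsUnique`).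

PRINT (p. 240 [PDF 18], verbatim).  *"The configurations ω, ω′ are defined on Λ and from the definition of δ_Ax we have
∫dω′↾_Λ δ(Q′₁ω′) Π_{y∈Λ′} δ_{Ax(y)}(Q_jA + ∂₁ω′) = 1. (2.96) Such an identity was used already in the change of gauge
formula (1.23). The quotient in the last line of (2.95) was introduced to change the gauge fixing term in the integral by
the Faddeev-Popov procedure. Let us apply (2.96) and (1.27) to the denominator."*  [4] (1.8) p. 18: *"(QA)(c) =
Σ_{x∈B(c₋)} L^{−(d+1)} A(Γ_{c,x})"* with `A(Γ) = Σ_{b⊂Γ} A(b)` the sum along the contour; (1.10) p. 19: the axial gauge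
`δ`-function `δ_Ax(A) = Π_{y} Π_{x∈B(y), x≠y} δ(A(Γ_{y,x}))`; `(Q′₁ω)(y) = Σ_{x∈B(y)} L^{−d}ω(x)` (site block average).

READING.  For a scalar `ω′` on the unit lattice and the contour `Γ_{y,x}` from the block centre `y` to `x ∈ B(y)`,
`(∂₁ω′)(Γ_{y,x}) = Σ_{b⊂Γ_{y,x}} (∂₁ω′)(b) = ω′(x) − ω′(y)` (telescoping, `gradient_telescope`); so the `δ`-functions of
(2.96) fix, block by block, the `L^d − 1` differences `ω′(x) − ω′(y)` (`x ∈ B(y)`, `x ≠ y`) and the block mean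
`(Q′₁ω′)(y) = L^{−d}Σ_{x∈B(y)}ω′(x)` — `L^d` linear conditions on the `L^d` variables `ω′↾_{B(y)}`.  The typed content of
*"= 1"* is therefore: the linear map `chart : ω′ ↦ (block means ; in-block differences to the centre)` of `ℝ^Λ` onto
`ℝ^Λ` (centre coordinates carry the means, non-centre coordinates the differences) is INVERTIBLE (exactly one admissible
`ω′` for every right-hand side — *"Such an identity was used already in the change of gauge formula (1.23)"*) with
`|det chart| = 1`, i.e. it preserves the product Lebesgue measure `dω′ = Π_x dω′(x)`: the `δ`-functions integrate to
exactly `1`, no Jacobian.  The block structure is abstracted as a finite site set `S` with an idempotent centre map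
`ctr` (`B(y) = ctr⁻¹(y)`, `y = ctr y` the centres); the printed one is the instance `S = Λ′ × (Fin d → Fin L)`,
`ctr(y,r) = (y,0)`, `|B(y)| = L^d` (§4).

CONTENTS (standard axioms; the chart and its two shear factors are `Matrix` definitions with bodies).
§1 `block`, `blockCard`, `shearA` (`ω ↦ ω − ω∘ctr` off the centres), `shearB` (adds `|B(y)|⁻¹Σ_{x≠y}` of the block to
   the centre coordinate), `chart = (1 + shearB)(1 + shearA)`; `chart_mulVec_of_ctr` (centre coordinate = the block MEAN
   `|B(y)|⁻¹Σ_{x∈B(y)}ω(x)` = `(Q′₁ω)(y)`), `chart_mulVec_of_not_ctr` (non-centre coordinate = `ω(x) − ω(ctr x)` =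
   `(∂₁ω)(Γ_{y,x})`), `gradient_telescope`.
§2 **`det_chart : det chart = 1`** — each shear is `1 + N·P` with `P·N = 0` (`P` the coordinate projection onto the
   centres, resp. the non-centres), so `det(1 + N·P) = det(1 + P·N) = 1` by the Weinstein–Aronszajn identity
   `Matrix.det_one_add_mul_comm`.
§3 **`map_chart_volume : volume.map chart = volume`** (`Real.map_matrix_volume_pi_eq_smul_volume_pi`),
   `measurePreserving_chart`, **`integral_comp_chart`** (`∫ F(chart ω′) dω′ = ∫ F dω′` for every `F` — the typed
   (2.96): conditioning on the values of the chart costs no Jacobian), `chart_existsUnique` (exactly one `ω′` per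
   prescribed means-and-differences).
§4 the printed block structure `ctrBlock` on `Λ′ × (Fin d → Fin L)`: `blockCard_ctrBlock = L^d`,
   **`chart_ctrBlock_mean`** (`= L^{−d}Σ_{x∈B(y)}ω(x)`), `chart_ctrBlock_diff`, **`eq296_ctrBlock`** (volume preserved).
HONEST SCOPE: the identification of print's `δ(·)` with unit point masses in these product-Lebesgue coordinates is the
reading above (print fixes no other normalisation: *"from the definition of δ_Ax"*); value = kernel certificate of the
displayed normalisation, NOT summit progress.  Unit `lit-balaban-p22` (gen 5), HOME `run/shared/lean/pub/lit-balaban/`.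
-/

noncomputable section

open Matrix MeasureTheory Finset

namespace Literature.MathematicalPhysics.QuantumFieldTheory.Balaban1983to89.B6Eq296UnitJacobian

/-! ## §1  The block chart `ω′ ↦ (block means ; differences to the centre)` -/

section Chart

variable {S : Type*} [Fintype S] [DecidableEq S] (ctr : S → S)

/-- The block `B(y) = {x : ctr x = y}` of a centre `y` (for a non-centre the set is empty).
[cite: Balaban1984PropagatorsII, (2.96) p.240] -/
def block (y : S) : Finset S := univ.filter fun x => ctr x = y

/-- `|B(y)|` (= `L^d` in print). [cite: Balaban1984PropagatorsII, (2.96) p.240] -/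
def blockCard (y : S) : ℕ := (block ctr y).card

/-- First shear: `(N_Aω)(x) = −ω(ctr x)` at non-centres, `0` at centres; `1 + N_A : ω ↦ (ω(x) − ω(ctr x))` off the
centres = the differences `(∂₁ω)(Γ_{y,x})` fixed by `δ_{Ax(y)}`. [cite: Balaban1984PropagatorsII, (2.96) p.240] -/
def shearA : Matrix S S ℝ := Matrix.of fun x x' => if ctr x = x then 0 else if x' = ctr x then -1 else 0

/-- Second shear: `(N_Bu)(y) = |B(y)|⁻¹ Σ_{x∈B(y), x≠y} u(x)` at centres `y`, `0` elsewhere; after the first shear it turns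
the centre coordinate into the block mean `(Q′₁ω)(y)` fixed by `δ(Q′₁ω′)`. [cite: Balaban1984PropagatorsII, (2.96) p.240] -/
def shearB : Matrix S S ℝ := Matrix.of fun x x' =>
  if ctr x = x then (if ctr x' = x ∧ x' ≠ x then ((blockCard ctr x : ℝ))⁻¹ else 0) else 0

/-- Coordinate projection onto the centre coordinates. [cite: Balaban1984PropagatorsII, (2.96) p.240] -/
def projC : Matrix S S ℝ := Matrix.diagonal fun x => if ctr x = x then (1 : ℝ) else 0

/-- Coordinate projection onto the non-centre coordinates. [cite: Balaban1984PropagatorsII, (2.96) p.240] -/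
def projD : Matrix S S ℝ := Matrix.diagonal fun x => if ctr x = x then (0 : ℝ) else 1

/-- **The chart of (2.96):** `chart ω = (1 + N_B)(1 + N_A)ω`; its centre coordinates are the block means `(Q′₁ω)(y)`,
its non-centre coordinates the differences `ω(x) − ω(y)`, `x ∈ B(y)` (`chart_mulVec_of_ctr` / `_of_not_ctr`).
[cite: Balaban1984PropagatorsII, (2.96) p.240] -/
def chart : Matrix S S ℝ := (1 + shearB ctr) * (1 + shearA ctr)

/-- `x ∈ B(y) ↔ ctr x = y`. [cite: Balaban1984PropagatorsII, (2.96) p.240] -/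
theorem mem_block {y x : S} : x ∈ block ctr y ↔ ctr x = y := by
  simp [block]

/-- The first shear in coordinates: `((1 + N_A)ω)(x) = ω(x) − ω(ctr x)` off the centres, `= ω(x)` at a centre.
[cite: Balaban1984PropagatorsII, (2.96) p.240] -/
theorem one_add_shearA_mulVec (ω : S → ℝ) (x : S) :
    ((1 + shearA ctr) *ᵥ ω) x = if ctr x = x then ω x else ω x - ω (ctr x) := by
  rw [add_mulVec, one_mulVec, Pi.add_apply, mulVec, dotProduct]
  by_cases hx : ctr x = x
  · simp [shearA, hx]
  · simp only [shearA, of_apply, hx, if_false, ite_mul, neg_mul, one_mul, zero_mul, Finset.sum_ite_eq',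
      Finset.mem_univ, if_true]
    ring

/-- The second shear in coordinates: `((1 + N_B)u)(y) = u(y) + |B(y)|⁻¹Σ_{x∈B(y),x≠y}u(x)` at a centre `y`, `= u(x)`
elsewhere. [cite: Balaban1984PropagatorsII, (2.96) p.240] -/
theorem one_add_shearB_mulVec (u : S → ℝ) (x : S) :
    ((1 + shearB ctr) *ᵥ u) x =
      if ctr x = x then u x + ((blockCard ctr x : ℝ))⁻¹ * ∑ x' ∈ (block ctr x).erase x, u x' else u x := by
  rw [add_mulVec, one_mulVec, Pi.add_apply, mulVec, dotProduct]
  by_cases hx : ctr x = x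
  · simp only [shearB, of_apply, hx, if_true, ite_mul, zero_mul]
    rw [← Finset.sum_filter, Finset.mul_sum]
    congr 1
    apply Finset.sum_congr
    · ext x'
      simp [block, and_comm]
    · intro x' _
      rfl
  · simp [shearB, hx]

/-- **Centre coordinates of the chart are the block means** `(Q′₁ω)(y) = |B(y)|⁻¹ Σ_{x∈B(y)} ω(x)` (`= L^{−d}Σ_{x∈B(y)}ω(x)`
in print). [cite: Balaban1984PropagatorsII, (2.96) p.240] -/
theorem chart_mulVec_of_ctr (ω : S → ℝ) {y : S} (hy : ctr y = y) :
    (chart ctr *ᵥ ω) y = ((blockCard ctr y : ℝ))⁻¹ * ∑ x ∈ block ctr y, ω x := by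
  rw [chart, ← mulVec_mulVec, one_add_shearB_mulVec, if_pos hy, one_add_shearA_mulVec, if_pos hy]
  have hmem : y ∈ block ctr y := (mem_block ctr).mpr hy
  have hcard : ((block ctr y).erase y).card + 1 = blockCard ctr y := by
    rw [blockCard]; exact Finset.card_erase_add_one hmem
  -- on the block minus its centre, the first shear subtracts `ω y`
  have hsum : ∑ x' ∈ (block ctr y).erase y, ((1 + shearA ctr) *ᵥ ω) x' =
      ∑ x' ∈ (block ctr y).erase y, ω x' - ((block ctr y).erase y).card * ω y := by
    rw [Finset.sum_congr rfl (g := fun x' => ω x' - ω y), Finset.sum_sub_distrib, Finset.sum_const, nsmul_eq_mul]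
    intro x' hx'
    obtain ⟨hne, hx'b⟩ := Finset.mem_erase.mp hx'
    have hcx' : ctr x' = y := (mem_block ctr).mp hx'b
    have hnc : ctr x' ≠ x' := by rw [hcx']; exact fun h => hne h.symm
    rw [one_add_shearA_mulVec, if_neg hnc, hcx']
  rw [hsum, ← Finset.add_sum_erase _ _ hmem]
  have hn : (blockCard ctr y : ℝ) ≠ 0 := by
    rw [← hcard]; positivity
  have hc : (((block ctr y).erase y).card : ℝ) = blockCard ctr y - 1 := by
    rw [← hcard]; push_cast; ring
  rw [hc]
  field_simp
  ring

/-- **Non-centre coordinates of the chart are the differences to the centre** `ω(x) − ω(ctr x)` (= `(∂₁ω)(Γ_{y,x})`,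
`y = ctr x`, in print). [cite: Balaban1984PropagatorsII, (2.96) p.240] -/
theorem chart_mulVec_of_not_ctr (ω : S → ℝ) {x : S} (hx : ctr x ≠ x) :
    (chart ctr *ᵥ ω) x = ω x - ω (ctr x) := by
  rw [chart, ← mulVec_mulVec, one_add_shearB_mulVec, if_neg hx, one_add_shearA_mulVec, if_neg hx]

omit [Fintype S] [DecidableEq S] in
/-- `(∂₁ω)(Γ_{y,x}) = Σ_{b⊂Γ_{y,x}}(ω(b₊) − ω(b₋)) = ω(x) − ω(y)`: the gradient summed along any contour from `y` to `x`
telescopes ([4] (1.8)/(1.10): contour sums). [cite: Balaban1984PropagatorsII, (2.96) p.240] -/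
theorem gradient_telescope (ω : S → ℝ) (p : ℕ → S) (n : ℕ) :
    ∑ i ∈ Finset.range n, (ω (p (i + 1)) - ω (p i)) = ω (p n) - ω (p 0) :=
  Finset.sum_range_sub (fun i => ω (p i)) n

end Chart

/-! ## §2  `det chart = 1` -/

section Det

variable {S : Type*} [Fintype S] [DecidableEq S] (ctr : S → S)

/-- `N_A = N_A·P_C` (the first shear only reads centre coordinates). [cite: Balaban1984PropagatorsII, (2.96) p.240] -/
theorem shearA_mul_projC (hctr : ∀ x, ctr (ctr x) = ctr x) : shearA ctr * projC ctr = shearA ctr := by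
  ext x x'
  rw [projC, mul_diagonal]
  simp only [shearA, of_apply]
  by_cases hx : ctr x = x
  · simp [hx]
  · by_cases hx' : x' = ctr x
    · simp [hx, hx', hctr]
    · simp [hx, hx']

/-- `P_C·N_A = 0` (the first shear does not touch centre coordinates). [cite: Balaban1984PropagatorsII, (2.96) p.240] -/
theorem projC_mul_shearA : projC ctr * shearA ctr = 0 := by
  ext x x'
  rw [projC, diagonal_mul]
  simp only [shearA, of_apply, Matrix.zero_apply]
  by_cases hx : ctr x = x <;> simp [hx]

/-- `N_B = N_B·P_D` (the second shear only reads non-centre coordinates). [cite: Balaban1984PropagatorsII, (2.96) p.240] -/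
theorem shearB_mul_projD : shearB ctr * projD ctr = shearB ctr := by
  ext x x'
  rw [projD, mul_diagonal]
  simp only [shearB, of_apply]
  by_cases hx : ctr x = x
  · by_cases h' : ctr x' = x ∧ x' ≠ x
    · have hne : x ≠ x' := fun h => h'.2 h.symm
      simp [h', hne]
    · simp [hx, h']
  · simp [hx]

/-- `P_D·N_B = 0` (the second shear does not touch non-centre coordinates). [cite: Balaban1984PropagatorsII, (2.96) p.240] -/
theorem projD_mul_shearB : projD ctr * shearB ctr = 0 := by
  ext x x'
  rw [projD, diagonal_mul]
  simp only [shearB, of_apply, Matrix.zero_apply]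
  by_cases hx : ctr x = x <;> simp [hx]

/-- `det(1 + N_A) = 1`: `N_A = N_A·P_C` and `P_C·N_A = 0`, so by Weinstein–Aronszajn `det(1 + N_AP_C) = det(1 + P_CN_A) =
det 1`. [cite: Balaban1984PropagatorsII, (2.96) p.240] -/
theorem det_one_add_shearA (hctr : ∀ x, ctr (ctr x) = ctr x) : (1 + shearA ctr).det = 1 := by
  calc (1 + shearA ctr).det = (1 + shearA ctr * projC ctr).det := by rw [shearA_mul_projC ctr hctr]
    _ = (1 + projC ctr * shearA ctr).det := Matrix.det_one_add_mul_comm _ _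
    _ = 1 := by rw [projC_mul_shearA, add_zero, det_one]

/-- `det(1 + N_B) = 1`, likewise with the projection onto the non-centre coordinates.
[cite: Balaban1984PropagatorsII, (2.96) p.240] -/
theorem det_one_add_shearB : (1 + shearB ctr).det = 1 := by
  calc (1 + shearB ctr).det = (1 + shearB ctr * projD ctr).det := by rw [shearB_mul_projD ctr]
    _ = (1 + projD ctr * shearB ctr).det := Matrix.det_one_add_mul_comm _ _
    _ = 1 := by rw [projD_mul_shearB, add_zero, det_one]

/-- **The unit Jacobian of (2.96):** `det chart = 1`. [cite: Balaban1984PropagatorsII, (2.96) p.240] -/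
theorem det_chart (hctr : ∀ x, ctr (ctr x) = ctr x) : (chart ctr).det = 1 := by
  rw [chart, det_mul, det_one_add_shearB, det_one_add_shearA ctr hctr, mul_one]

end Det

/-! ## §3  Volume preservation: the `δ`-functions of (2.96) integrate to `1` -/

section Volume

variable {S : Type*} [Fintype S] [DecidableEq S] (ctr : S → S)

/-- **(2.96), measure form:** the chart preserves the product Lebesgue measure `dω′ = Π_x dω′(x)` —
`volume.map chart = |det chart|⁻¹ • volume = volume`. [cite: Balaban1984PropagatorsII, (2.96) p.240] -/
theorem map_chart_volume (hctr : ∀ x, ctr (ctr x) = ctr x) :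
    Measure.map (toLin' (chart ctr)) volume = volume := by
  rw [Real.map_matrix_volume_pi_eq_smul_volume_pi (by rw [det_chart ctr hctr]; exact one_ne_zero),
    det_chart ctr hctr, inv_one, abs_one, ENNReal.ofReal_one, one_smul]

/-- The chart is measure preserving. [cite: Balaban1984PropagatorsII, (2.96) p.240] -/
theorem measurePreserving_chart (hctr : ∀ x, ctr (ctr x) = ctr x) :
    MeasurePreserving (toLin' (chart ctr)) volume volume :=
  ⟨(LinearMap.continuous_on_pi _).measurable, map_chart_volume ctr hctr⟩

/-- The chart as a linear equivalence (invertible: `det = 1`). [cite: Balaban1984PropagatorsII, (2.96) p.240] -/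
def chartEquiv (hctr : ∀ x, ctr (ctr x) = ctr x) : (S → ℝ) ≃ₗ[ℝ] (S → ℝ) :=
  (chart ctr).toLinearEquiv' (Matrix.invertibleOfIsUnitDet _ (by rw [det_chart ctr hctr]; exact isUnit_one))

/-- The equivalence acts as the chart. [cite: Balaban1984PropagatorsII, (2.96) p.240] -/
theorem chartEquiv_apply (hctr : ∀ x, ctr (ctr x) = ctr x) (ω : S → ℝ) :
    chartEquiv ctr hctr ω = chart ctr *ᵥ ω := by
  show ((chartEquiv ctr hctr : (S → ℝ) ≃ₗ[ℝ] (S → ℝ)) : Module.End ℝ (S → ℝ)) ω = _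
  rw [chartEquiv, toLinearEquiv'_apply, toLin'_apply]

/-- *"exactly one admissible ω′"*: for every prescription `v` of the block means (at the centres) and of the differences
to the centre (elsewhere) there is exactly one `ω′` realising it — the existence-and-uniqueness half of (2.96) for the
one-level block structure (*"Such an identity was used already in the change of gauge formula (1.23)"*).
[cite: Balaban1984PropagatorsII, (2.96) p.240] -/
theorem chart_existsUnique (hctr : ∀ x, ctr (ctr x) = ctr x) (v : S → ℝ) : ∃! ω : S → ℝ, chart ctr *ᵥ ω = v := by
  refine ⟨(chartEquiv ctr hctr).symm v, ?_, fun ω hω => ?_⟩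
  · show chart ctr *ᵥ (chartEquiv ctr hctr).symm v = v
    rw [← chartEquiv_apply ctr hctr, LinearEquiv.apply_symm_apply]
  · have hω' : chart ctr *ᵥ ω = v := hω
    rw [← chartEquiv_apply ctr hctr] at hω'
    rw [← hω', LinearEquiv.symm_apply_apply]

/-- **(2.96) as an identity of integrals — the unit Jacobian:** for EVERY function `F` of the block means and of the
in-block differences, `∫ F(chart ω′) dω′ = ∫ F(v) dv`; i.e. conditioning `dω′` on the values `(Q′₁ω′, (∂₁ω′)(Γ_{y,x}))`
of the `δ`-functions in (2.96) carries Jacobian exactly `1` — the `δ`'s integrate to `1`.  No integrability hypothesis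
(both sides are junk together). [cite: Balaban1984PropagatorsII, (2.96) p.240] -/
theorem integral_comp_chart {E : Type*} [NormedAddCommGroup E] [NormedSpace ℝ E] (hctr : ∀ x, ctr (ctr x) = ctr x)
    (F : (S → ℝ) → E) : ∫ ω, F (chart ctr *ᵥ ω) = ∫ v, F v := by
  have hfe : MeasurableEmbedding (toLin' (chart ctr)) := by
    have h := (chartEquiv ctr hctr).toContinuousLinearEquiv.toHomeomorph.measurableEmbedding
    convert h using 1
    funext ω
    rw [toLin'_apply, ← chartEquiv_apply ctr hctr]
    rfl
  have h := (measurePreserving_chart ctr hctr).integral_comp hfe F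
  simpa only [toLin'_apply] using h

end Volume

/-! ## §4  The printed block structure: `Λ′ × (Fin d → Fin L)`, blocks of `L^d` sites, weight `L^{−d}` -/

section Blocks

variable (Λ' : Type*) (d L : ℕ) [NeZero L]

/-- The sites of `Λ = B(Λ′)` labelled `(y, r)`: block label `y ∈ Λ′` and position `r ∈ {0,…,L−1}^d` in the block, the
centre being `r = 0`; `ctr(y,r) = (y,0)`. [cite: Balaban1984PropagatorsII, (2.96) p.240] -/
def ctrBlock : Λ' × (Fin d → Fin L) → Λ' × (Fin d → Fin L) := fun x => (x.1, 0)

/-- Centres are fixed: `ctr ∘ ctr = ctr`. [cite: Balaban1984PropagatorsII, (2.96) p.240] -/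
theorem ctrBlock_idem (x : Λ' × (Fin d → Fin L)) : ctrBlock Λ' d L (ctrBlock Λ' d L x) = ctrBlock Λ' d L x := rfl

/-- The centres are the sites `(y, 0)`. [cite: Balaban1984PropagatorsII, (2.96) p.240] -/
theorem ctrBlock_eq_self_iff (x : Λ' × (Fin d → Fin L)) : ctrBlock Λ' d L x = x ↔ x.2 = 0 := by
  constructor
  · intro h
    have := congrArg Prod.snd h
    simpa [ctrBlock] using this.symm
  · intro h
    ext <;> simp [ctrBlock, h]

variable [Fintype Λ'] [DecidableEq Λ']

/-- `B(y) = {y} × {0,…,L−1}^d`. [cite: Balaban1984PropagatorsII, (2.96) p.240] -/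
theorem block_ctrBlock (y : Λ') :
    block (ctrBlock Λ' d L) (y, 0) = ({y} : Finset Λ') ×ˢ (univ : Finset (Fin d → Fin L)) := by
  ext ⟨y', r⟩
  simp only [block, ctrBlock, Finset.mem_filter, Finset.mem_univ, true_and, Finset.mem_product,
    Finset.mem_singleton, and_true, Prod.mk.injEq]

/-- `|B(y)| = L^d`. [cite: Balaban1984PropagatorsII, (2.96) p.240] -/
theorem blockCard_ctrBlock (y : Λ') : blockCard (ctrBlock Λ' d L) (y, 0) = L ^ d := by
  rw [blockCard, block_ctrBlock, Finset.card_product, Finset.card_singleton, one_mul, Finset.card_univ,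
    Fintype.card_fun, Fintype.card_fin, Fintype.card_fin]

/-- **The centre coordinate is `(Q′₁ω)(y) = L^{−d}Σ_{x∈B(y)}ω(x)`.** [cite: Balaban1984PropagatorsII, (2.96) p.240] -/
theorem chart_ctrBlock_mean (ω : Λ' × (Fin d → Fin L) → ℝ) (y : Λ') :
    (chart (ctrBlock Λ' d L) *ᵥ ω) (y, 0) = ((L : ℝ) ^ d)⁻¹ * ∑ r : Fin d → Fin L, ω (y, r) := by
  rw [chart_mulVec_of_ctr (ctrBlock Λ' d L) ω (by rfl), blockCard_ctrBlock, block_ctrBlock]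
  push_cast
  congr 1
  rw [Finset.sum_product, Finset.sum_singleton]

/-- **The non-centre coordinates are `(∂₁ω)(Γ_{y,x}) = ω(x) − ω(y)`.** [cite: Balaban1984PropagatorsII, (2.96) p.240] -/
theorem chart_ctrBlock_diff (ω : Λ' × (Fin d → Fin L) → ℝ) (y : Λ') {r : Fin d → Fin L} (hr : r ≠ 0) :
    (chart (ctrBlock Λ' d L) *ᵥ ω) (y, r) = ω (y, r) - ω (y, 0) :=
  chart_mulVec_of_not_ctr (ctrBlock Λ' d L) ω (by rw [Ne, ctrBlock_eq_self_iff]; exact hr)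

/-- **(2.96) on the printed block structure:** `det = 1` and the product Lebesgue measure `dω′` is preserved by
`ω′ ↦ ((Q′₁ω′)(y))_y ⊕ ((∂₁ω′)(Γ_{y,x}))_{x≠y}` — *"∫dω′↾_Λ δ(Q′₁ω′) Π_{y∈Λ′} δ_{Ax(y)}(Q_jA + ∂₁ω′) = 1"*.
[cite: Balaban1984PropagatorsII, (2.96) p.240] -/
theorem eq296_ctrBlock :
    (chart (ctrBlock Λ' d L)).det = 1 ∧ Measure.map (toLin' (chart (ctrBlock Λ' d L))) volume = volume :=
  ⟨det_chart _ (ctrBlock_idem Λ' d L), map_chart_volume _ (ctrBlock_idem Λ' d L)⟩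

/-- (2.96) on the printed block structure, integral form: `∫ F((Q′₁ω′)_y, ((∂₁ω′)(Γ_{y,x}))_{x≠y}) dω′ = ∫ F(v) dv` for
every `F`. [cite: Balaban1984PropagatorsII, (2.96) p.240] -/
theorem integral_comp_chart_ctrBlock {E : Type*} [NormedAddCommGroup E] [NormedSpace ℝ E]
    (F : (Λ' × (Fin d → Fin L) → ℝ) → E) :
    ∫ ω, F (chart (ctrBlock Λ' d L) *ᵥ ω) = ∫ v, F v :=
  integral_comp_chart _ (ctrBlock_idem Λ' d L) F

end Blocks

end Literature.MathematicalPhysics.QuantumFieldTheory.Balaban1983to89.B6Eq296UnitJacobian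

end
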